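import Summits.FinalStateConjecture.FinalStateConjecture.Theorems.EIHFluxBalanceInertialRecessionBoostCalculus
import Summits.FinalStateConjecture.FinalStateConjecture.Theorems.EIHFluxBalanceInertialRecessionLorentz

/-!
# Route EIHFluxBalance — `InertialRecession`: rest-frame offsets of a moving hole (boost algebra)

Helper file for the crux `stmt-FinalStateConjecture-10166`
(`Summit.FinalStateConjecture.FinalStateConjecture.Theses.EIHFluxBalance.InertialRecession`).

In the crux's lab ansatz, hole `i` at lab time `t` is the Kerr–Schild form in the frame `Λᵢ(t)`
centred at `cᵢ(t) = (t, ξᵢ(t))`; its field at a lab point `x` of the slab `{x⁰ = t}` depends on the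
rest-frame offset `Λᵢ(t)⁻¹(0, x̲ − ξᵢ(t))`. For a frame with lab velocity `v` (`(Λe₀)~ = (Λe₀)⁰ v`)
the spatial part of `Λ⁻¹(0, z)` is, up to a rotation, `P_v z = z + (γ²/(γ+1)) ⟪v, z⟫ v`
(`γ = γ(v)`), with inverse `L_v z = z − (γ/(γ+1)) ⟪v, z⟫ v`. The hole charts of the re-charting
place the model point with rest offset `z` at the lab point `(θ, ξᵢ(θ) + L_{vᵢ(θ)} z)`; this file is
the algebra making that work:

* `spatial_boostCLM_neg_ofTimeSpace_zero` — `(boost(−v)(0, z))~ = P_v z`;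
* `restOffset_leftInverse`, `restOffset_rightInverse`, `inner_restOffset`, `norm_sq_restOffset`,
  `norm_restOffset_le`, `le_norm_restOffset` — `L_v = P_v⁻¹`, `⟪v, L_v z⟫ = ⟪v, z⟫/γ`,
  `‖L_v z‖² = ‖z‖² − ⟪v, z⟫²`, `‖z‖/γ… ≤ ‖L_v z‖ ≤ ‖z‖`;
* `spatialNorm_symm_ofTimeSpace_restOffset'` (registered form unprimed) — **exact horizon normalisation**: for ANY Lorentz
  frame `Λ` with future unit `Λe₀` of lab velocity `v`, `‖(Λ⁻¹(0, L_v z))~‖ = ‖z‖`: the painted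
  Kerr–Schild radius (spin `0`) of the lab point `(t, ξ + L_v z)` is `‖z‖`;
* `boostCLM_eq_ofTimeSpace_restOffset'` (registered form unprimed) — `boost(V) y = (w, w V + L_V y̲)`, `w = γ(y⁰ + ⟪V, y̲⟫)`:
  in the exactly boosted case the re-charting map is the identity;
* `contDiffOn_restOffsetCLM`, `restOffsetCLM_apply` — `v ↦ L_v` is smooth on the unit ball.
-/

noncomputable section

open scoped Topology ContDiff InnerProductSpace
open Filter Set Metric TopologicalSpace Literature.Geometry.Lorentzian

namespace Summit.FinalStateConjecture.FinalStateConjecture.Theorems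

/-! ### `P_v` and `L_v` -/

/-- `γ(v) + 1 ≠ 0` (indeed `γ ≥ 0` by definition as an inverse square root). [folklore] -/
theorem lorentzGamma_add_one_pos (v : E3) : 0 < Lorentz.gamma v + 1 := by
  have : 0 ≤ Lorentz.gamma v := inv_nonneg.mpr (Real.sqrt_nonneg _)
  linarith

/-- The spatial part of `boost(−v)(0, z)` is `P_v z = z + (γ²/(γ+1)) ⟪v, z⟫ v` (Jackson (11.19)).
[folklore] -/
theorem spatial_boostCLM_neg_ofTimeSpace_zero (v z : E3) :
    E4.spatial (Lorentz.boostCLM (-v) (E4.ofTimeSpace 0 z)) =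
      z + (Lorentz.gamma v ^ 2 / (Lorentz.gamma v + 1) * inner ℝ v z) • v := by
  rw [Lorentz.spatial_boostCLM_apply, lorentzGamma_neg, E4.spatial_ofTimeSpace,
    E4.ofTimeSpace_apply_zero, mul_zero, add_zero, inner_neg_left, smul_neg, ← neg_smul]
  congr 1
  ring

/-- The time component of `boost(−v)(0, z)` is `−γ ⟪v, z⟫` (Jackson (11.19)). [folklore] -/
theorem boostCLM_neg_ofTimeSpace_zero_apply_zero (v z : E3) :
    Lorentz.boostCLM (-v) (E4.ofTimeSpace 0 z) 0 = -(Lorentz.gamma v * inner ℝ v z) := by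
  rw [Lorentz.boostCLM_apply_zero, lorentzGamma_neg, E4.spatial_ofTimeSpace,
    E4.ofTimeSpace_apply_zero, zero_add, inner_neg_left, mul_neg]

/-- `γ ‖v‖² = γ − 1/γ` for `‖v‖ < 1` (from `γ²(1 − ‖v‖²) = 1`). [folklore] -/
theorem lorentzGamma_mul_norm_sq {v : E3} (hv : ‖v‖ < 1) :
    Lorentz.gamma v * ‖v‖ ^ 2 = Lorentz.gamma v - (Lorentz.gamma v)⁻¹ := by
  have h := Lorentz.gamma_sq_mul hv
  have hγ := Lorentz.gamma_pos hv
  field_simp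
  nlinarith

/-- `⟪v, L_v z⟫ = ⟪v, z⟫ / γ`. [folklore] -/
theorem inner_restOffset {v : E3} (hv : ‖v‖ < 1) (z : E3) :
    inner ℝ v (z - (Lorentz.gamma v / (Lorentz.gamma v + 1) * inner ℝ v z) • v) =
      inner ℝ v z / Lorentz.gamma v := by
  have hγ := Lorentz.gamma_pos hv
  have hγ1 := lorentzGamma_add_one_pos v
  have hk := Lorentz.gamma_sq_mul hv
  rw [inner_sub_right, inner_smul_right, real_inner_self_eq_norm_sq]
  field_simp
  linear_combination (inner ℝ v z) * hk

/-- `⟪v, P_v z⟫ = γ ⟪v, z⟫`. [folklore] -/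
theorem inner_restOffsetInv {v : E3} (hv : ‖v‖ < 1) (z : E3) :
    inner ℝ v (z + (Lorentz.gamma v ^ 2 / (Lorentz.gamma v + 1) * inner ℝ v z) • v) =
      Lorentz.gamma v * inner ℝ v z := by
  have hγ := Lorentz.gamma_pos hv
  have hγ1 := lorentzGamma_add_one_pos v
  have hk := Lorentz.gamma_sq_mul hv
  rw [inner_add_right, inner_smul_right, real_inner_self_eq_norm_sq]
  field_simp
  linear_combination (-(inner ℝ v z)) * hk

/-- `P_v (L_v z) = z`. [folklore] -/
theorem restOffset_leftInverse {v : E3} (hv : ‖v‖ < 1) (z : E3) :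
    (z - (Lorentz.gamma v / (Lorentz.gamma v + 1) * inner ℝ v z) • v) +
      (Lorentz.gamma v ^ 2 / (Lorentz.gamma v + 1) *
        inner ℝ v (z - (Lorentz.gamma v / (Lorentz.gamma v + 1) * inner ℝ v z) • v)) • v = z := by
  have hγ := Lorentz.gamma_pos hv
  have hγ1 := lorentzGamma_add_one_pos v
  rw [inner_restOffset hv]
  have key : Lorentz.gamma v ^ 2 / (Lorentz.gamma v + 1) * (inner ℝ v z / Lorentz.gamma v) =
      Lorentz.gamma v / (Lorentz.gamma v + 1) * inner ℝ v z := by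
    field_simp
  rw [key, sub_add_cancel]

/-- `L_v (P_v z) = z`. [folklore] -/
theorem restOffset_rightInverse {v : E3} (hv : ‖v‖ < 1) (z : E3) :
    (z + (Lorentz.gamma v ^ 2 / (Lorentz.gamma v + 1) * inner ℝ v z) • v) -
      (Lorentz.gamma v / (Lorentz.gamma v + 1) *
        inner ℝ v (z + (Lorentz.gamma v ^ 2 / (Lorentz.gamma v + 1) * inner ℝ v z) • v)) • v =
      z := by
  have hγ := Lorentz.gamma_pos hv
  have hγ1 := lorentzGamma_add_one_pos v
  rw [inner_restOffsetInv hv]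
  have key : Lorentz.gamma v / (Lorentz.gamma v + 1) * (Lorentz.gamma v * inner ℝ v z) =
      Lorentz.gamma v ^ 2 / (Lorentz.gamma v + 1) * inner ℝ v z := by
    field_simp
  rw [key, add_sub_cancel_right]

/-- `‖L_v z‖² = ‖z‖² − ⟪v, z⟫²`. [folklore] -/
theorem norm_sq_restOffset {v : E3} (hv : ‖v‖ < 1) (z : E3) :
    ‖z - (Lorentz.gamma v / (Lorentz.gamma v + 1) * inner ℝ v z) • v‖ ^ 2 =
      ‖z‖ ^ 2 - inner ℝ v z ^ 2 := by
  have hγ := Lorentz.gamma_pos hv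
  have hγ1 := lorentzGamma_add_one_pos v
  have hk := Lorentz.gamma_sq_mul hv
  rw [← real_inner_self_eq_norm_sq, inner_sub_left, inner_sub_right, inner_sub_right,
    inner_smul_left, inner_smul_right, inner_smul_left, inner_smul_right, real_inner_self_eq_norm_sq,
    real_inner_self_eq_norm_sq, real_inner_comm z v]
  simp only [conj_trivial]
  field_simp
  linear_combination (-(inner ℝ z v) ^ 2) * hk

/-- `‖L_v z‖ ≤ ‖z‖`. [folklore] -/
theorem norm_restOffset_le {v : E3} (hv : ‖v‖ < 1) (z : E3) :
    ‖z - (Lorentz.gamma v / (Lorentz.gamma v + 1) * inner ℝ v z) • v‖ ≤ ‖z‖ := by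
  refine (sq_le_sq₀ (norm_nonneg _) (norm_nonneg _)).mp ?_
  rw [norm_sq_restOffset hv]
  nlinarith [sq_nonneg (inner ℝ v z)]

/-- `‖z‖² (1 − ‖v‖²) ≤ ‖L_v z‖²` (Cauchy–Schwarz). [folklore] -/
theorem le_norm_sq_restOffset {v : E3} (hv : ‖v‖ < 1) (z : E3) :
    ‖z‖ ^ 2 * (1 - ‖v‖ ^ 2) ≤
      ‖z - (Lorentz.gamma v / (Lorentz.gamma v + 1) * inner ℝ v z) • v‖ ^ 2 := by
  rw [norm_sq_restOffset hv]
  have h := abs_real_inner_le_norm v z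
  have h2 : inner ℝ v z ^ 2 ≤ (‖v‖ * ‖z‖) ^ 2 := by
    rw [← sq_abs]
    exact pow_le_pow_left₀ (abs_nonneg _) h 2
  nlinarith

/-! ### Exact horizon normalisation -/

/-- For a Lorentz frame with future time leg, `(Λe₀)⁰ = γ(v)` where `v` is its lab velocity
(`(Λe₀)~ = (Λe₀)⁰ v`). [folklore] -/
theorem lorentz_apply_zero_eq_gamma (Λ : lorentzGroup)
    (h0 : 0 < ((Λ : E4 ≃L[ℝ] E4) (E4.basisVector 0)) 0) {v : E3}
    (hv : E4.spatial ((Λ : E4 ≃L[ℝ] E4) (E4.basisVector 0)) =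
      (((Λ : E4 ≃L[ℝ] E4) (E4.basisVector 0)) 0) • v) :
    ‖v‖ < 1 ∧ ((Λ : E4 ≃L[ℝ] E4) (E4.basisVector 0)) 0 = Lorentz.gamma v := by
  set u0 : ℝ := ((Λ : E4 ≃L[ℝ] E4) (E4.basisVector 0)) 0 with hu0
  have hsq := lorentz_apply_zero_sq Λ
  have hn : E4.spatialNorm ((Λ : E4 ≃L[ℝ] E4) (E4.basisVector 0)) = u0 * ‖v‖ := by
    rw [E4.spatialNorm, hv, norm_smul, Real.norm_of_nonneg h0.le]
  rw [hn, ← hu0] at hsq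
  have hkey : u0 ^ 2 * (1 - ‖v‖ ^ 2) = 1 := by nlinarith
  have hv1 : ‖v‖ < 1 := by
    by_contra hc
    have : 1 ≤ ‖v‖ ^ 2 := by nlinarith [not_lt.mp hc, norm_nonneg v]
    nlinarith
  refine ⟨hv1, ?_⟩
  have hγ := Lorentz.gamma_sq_mul hv1
  have hγp := Lorentz.gamma_pos hv1
  have h1 : u0 ^ 2 = Lorentz.gamma v ^ 2 := by
    have hp : 0 < 1 - ‖v‖ ^ 2 := Lorentz.one_sub_norm_sq_pos hv1
    nlinarith
  nlinarith [sq_nonneg (u0 - Lorentz.gamma v), sq_nonneg (u0 + Lorentz.gamma v)]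

/-- **Exact horizon normalisation.** For any Lorentz frame `Λ` whose time leg `Λe₀` is future
pointing with lab velocity `v`, and any rest offset `z`,
`‖(Λ⁻¹(0, L_v z))~‖ = ‖z‖`: the painted (spin-`0`) Kerr–Schild radius of the lab point
`(t, ξ + L_v z)` relative to the hole `(Λ, (t, ξ))` is exactly `‖z‖` — independently of the
rotational part of `Λ`. (`η`-invariance: `‖w~‖² = ‖(0, z')‖² + (w⁰)²`, `w⁰ = −γ⟪v, z'⟫`,
`‖L_v z‖² + ⟪v, z⟫² = ‖z‖²`.) [folklore] -/
theorem spatialNorm_symm_ofTimeSpace_restOffset' (Λ : lorentzGroup)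
    (h0 : 0 < ((Λ : E4 ≃L[ℝ] E4) (E4.basisVector 0)) 0) {v : E3}
    (hv : E4.spatial ((Λ : E4 ≃L[ℝ] E4) (E4.basisVector 0)) =
      (((Λ : E4 ≃L[ℝ] E4) (E4.basisVector 0)) 0) • v) (z : E3) :
    E4.spatialNorm ((Λ : E4 ≃L[ℝ] E4).symm
      (E4.ofTimeSpace 0 (z - (Lorentz.gamma v / (Lorentz.gamma v + 1) * inner ℝ v z) • v))) =
      ‖z‖ := by
  obtain ⟨hv1, hγe⟩ := lorentz_apply_zero_eq_gamma Λ h0 hv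
  set z' : E3 := z - (Lorentz.gamma v / (Lorentz.gamma v + 1) * inner ℝ v z) • v with hz'
  set y : E4 := E4.ofTimeSpace 0 z' with hy
  set w : E4 := (Λ : E4 ≃L[ℝ] E4).symm y with hw
  have hy0 : y 0 = 0 := E4.ofTimeSpace_apply_zero 0 z'
  have hys : E4.spatial y = z' := E4.spatial_ofTimeSpace 0 z'
  -- `‖w~‖² = ‖y‖² + (w⁰)²`
  have h1 : E4.spatialNorm w ^ 2 = ‖y‖ ^ 2 + w 0 ^ 2 := by
    have := spatialNorm_lorentz_apply_sq Λ⁻¹ hy0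
    rwa [coe_lorentz_inv] at this
  -- `w⁰ = −(Λe₀)⁰ ⟪v, z'⟫`
  have h2 : w 0 = -((((Λ : E4 ≃L[ℝ] E4) (E4.basisVector 0)) 0) * inner ℝ v z') := by
    have e1 := minkowski_bilin_basisVector_zero_left w
    have e2 := Λ.2 (E4.basisVector 0) w
    rw [hw, ContinuousLinearEquiv.apply_symm_apply] at e2
    rw [← hw] at e2
    have e3 := minkowski_bilin_of_apply_zero_eq_zero ((Λ : E4 ≃L[ℝ] E4) (E4.basisVector 0)) hy0
    rw [hv, hys, inner_smul_left] at e3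
    simp only [conj_trivial] at e3
    linarith
  have h3 : ‖y‖ = ‖z'‖ := by
    rw [norm_eq_spatialNorm_of_apply_zero_eq_zero hy0, show E4.spatialNorm y = ‖E4.spatial y‖
      from rfl, hys]
  have h4 : ‖z'‖ ^ 2 = ‖z‖ ^ 2 - inner ℝ v z ^ 2 := norm_sq_restOffset hv1 z
  have h5 : inner ℝ v z' = inner ℝ v z / Lorentz.gamma v := inner_restOffset hv1 z
  have hγp := Lorentz.gamma_pos hv1
  have h6 : E4.spatialNorm w ^ 2 = ‖z‖ ^ 2 := by
    rw [h1, h2, h3, hγe, h5, h4]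
    field_simp
    ring
  have hn : 0 ≤ E4.spatialNorm w := E4.spatialNorm_nonneg w
  nlinarith [norm_nonneg z, sq_nonneg (E4.spatialNorm w - ‖z‖), sq_nonneg (E4.spatialNorm w + ‖z‖)]

/-! ### The exactly boosted case -/

/-- `boost(V) y = (w, w V + L_V y̲)` with `w = γ(y⁰ + ⟪V, y̲⟫)`: the pure boost sends the rest
point `y` to lab time `w` and lab position `w V + L_V y̲` — in the exactly boosted case the
re-charting map `(w, ξ(w) + L_{v(w)} y̲)` with `ξ(w) = w V`, `v ≡ V` is the boost itself.
[folklore] -/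
theorem boostCLM_eq_ofTimeSpace_restOffset' (V : E3) (y : E4) :
    Lorentz.boostCLM V y =
      E4.ofTimeSpace (Lorentz.gamma V * (y 0 + inner ℝ V (E4.spatial y)))
        ((Lorentz.gamma V * (y 0 + inner ℝ V (E4.spatial y))) • V +
          (E4.spatial y - (Lorentz.gamma V / (Lorentz.gamma V + 1) * inner ℝ V (E4.spatial y)) • V)) := by
  have hγ1 := lorentzGamma_add_one_pos V
  rw [← E4.ofTimeSpace_time_spatial (Lorentz.boostCLM V y), E4.time_apply,
    Lorentz.boostCLM_apply_zero, Lorentz.spatial_boostCLM_apply]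
  congr 1
  have key : Lorentz.gamma V ^ 2 / (Lorentz.gamma V + 1) * inner ℝ V (E4.spatial y) +
      Lorentz.gamma V * y 0 =
      Lorentz.gamma V * (y 0 + inner ℝ V (E4.spatial y)) -
        Lorentz.gamma V / (Lorentz.gamma V + 1) * inner ℝ V (E4.spatial y) := by
    field_simp
    ring
  rw [key, sub_smul]
  abel

/-! ### Smooth dependence of `L_v` on `v` -/

/-- `v ↦ L_v = 1 − (γ/(γ+1)) ⟪v, ·⟫ v` is smooth on the open unit ball (as a `CLM`-valued map).
[folklore] -/
theorem contDiffOn_restOffsetCLM :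
    ContDiffOn ℝ ∞ (fun v : E3 ↦ ContinuousLinearMap.id ℝ E3 -
      (Lorentz.gamma v / (Lorentz.gamma v + 1)) • (innerSL ℝ v).smulRight v) (ball (0 : E3) 1) := by
  have hγ := contDiffOn_lorentzGamma
  have hden : ∀ v ∈ ball (0 : E3) 1, Lorentz.gamma v + 1 ≠ 0 :=
    fun v _ ↦ (lorentzGamma_add_one_pos v).ne'
  have hi : ContDiff ℝ ∞ (fun v : E3 ↦ innerSL ℝ v) := (innerSL ℝ (E := E3)).contDiff
  have hsr : ContDiff ℝ ∞ (fun v : E3 ↦ (innerSL ℝ v).smulRight v) := hi.smulRight contDiff_id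
  exact contDiffOn_const.sub ((hγ.div (hγ.add contDiffOn_const) hden).smul hsr.contDiffOn)

/-- Unfolding: `L_v z = z − (γ/(γ+1)) ⟪v, z⟫ v`. [folklore] -/
theorem restOffsetCLM_apply (v z : E3) :
    (ContinuousLinearMap.id ℝ E3 -
      (Lorentz.gamma v / (Lorentz.gamma v + 1)) • (innerSL ℝ v).smulRight v) z =
      z - (Lorentz.gamma v / (Lorentz.gamma v + 1) * inner ℝ v z) • v := by
  simp [mul_smul]

/-! ### Registered forms -/

/-- Registered sub-goal form (stub `spatialNorm_symm_ofTimeSpace_restOffset` of the crux item) of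
`spatialNorm_symm_ofTimeSpace_restOffset'`. [folklore] -/
theorem spatialNorm_symm_ofTimeSpace_restOffset : open Literature.Geometry.Lorentzian in ∀ (Λ : lorentzGroup), 0 < ((Λ : E4 ≃L[ℝ] E4) (E4.basisVector 0)) 0 → ∀ {v : E3}, E4.spatial ((Λ : E4 ≃L[ℝ] E4) (E4.basisVector 0)) = (((Λ : E4 ≃L[ℝ] E4) (E4.basisVector 0)) 0) • v → ∀ z : E3, E4.spatialNorm ((Λ : E4 ≃L[ℝ] E4).symm (E4.ofTimeSpace 0 (z - (Lorentz.gamma v / (Lorentz.gamma v + 1) * inner ℝ v z) • v))) = ‖z‖ :=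
  fun Λ h0 _ hv z ↦ spatialNorm_symm_ofTimeSpace_restOffset' Λ h0 hv z

/-- Registered sub-goal form (stub `boostCLM_eq_ofTimeSpace_restOffset` of the crux item) of
`boostCLM_eq_ofTimeSpace_restOffset'`. [folklore] -/
theorem boostCLM_eq_ofTimeSpace_restOffset : open Literature.Geometry.Lorentzian in ∀ (V : E3) (y : E4), Lorentz.boostCLM V y = E4.ofTimeSpace (Lorentz.gamma V * (y 0 + inner ℝ V (E4.spatial y))) ((Lorentz.gamma V * (y 0 + inner ℝ V (E4.spatial y))) • V + (E4.spatial y - (Lorentz.gamma V / (Lorentz.gamma V + 1) * inner ℝ V (E4.spatial y)) • V)) :=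
  boostCLM_eq_ofTimeSpace_restOffset'

end Summit.FinalStateConjecture.FinalStateConjecture.Theorems

end
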